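import Mathlib
import HarnessLib
import Summits.HubbardSuperconductivity.HubbardSuperconductivity.Theorems.KLProgrammeKLRegimeTwoVolumeTowerStepCovZeroPullback
import Summits.HubbardSuperconductivity.HubbardSuperconductivity.Theorems.KLProgrammeKLRegimeSliceSymbolTorusThird
import Summits.HubbardSuperconductivity.HubbardSuperconductivity.Theorems.KLProgrammeKLRegimeTorusL1ThirdDifferencesMoment
import Summits.HubbardSuperconductivity.HubbardSuperconductivity.Theorems.KLProgrammeKLRegimeSectorSlicePairSectional
import Summits.HubbardSuperconductivity.HubbardSuperconductivity.Theorems.KLProgrammeKLRegimeSectorSliceIncrRates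
import Summits.HubbardSuperconductivity.HubbardSuperconductivity.Theorems.KLProgrammeKLRegimeFrameOKDerivBounds
import Summits.HubbardSuperconductivity.HubbardSuperconductivity.Theorems.KLProgrammeSalmhoferCutoffDerivBound
import Summits.HubbardSuperconductivity.HubbardSuperconductivity.Theorems.KLProgrammeSalmhoferCutoffSecondDerivBound
import Summits.HubbardSuperconductivity.HubbardSuperconductivity.Theorems.KLProgrammeSalmhoferCutoffThirdDerivBound

/-!
# K3 VL child `KLRegimeVolumeLimitV17F2` (stmt-HubbardSuperconductivity-20440), located item «SCALE-0-STEPCOV», part 2a (PLAIN SYMBOL DATA): pointwise data of the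
# plain slice symbol `(βV²)⁻²·Ψ̂_{(Λ₂,Λ₁]}[K]` on the product torus `(ℤ/2M)¹ × (ℤ/V)²` at ONE admissible frame — sup, third / second spatial differences along
# a unit integer direction (order-three size `‖D³e_K‖ ≤ K₃` as a hypothesis), third time difference in the regime window

Cell `gate-hubbard-kl`, seat p3 (g17).  Part 1 (`…StepCovZeroPullback`, p634904) reduced the weighted rows / columns / sectional rows of `klStepCov V M β μ K 0`
to weighted `ℓ¹` norms of ONE character sum with symbol `G = (βV²)⁻²Ψ̂_{(Λ₂,Λ₁]}(ω(q₁), e_K(q₂))`.  The master lemmas that bound such norms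
(`sum_wt_norm_charSum_le_of_third_differences`, `sliceCharSumWt_sectional_le_of_mixed_data`) read pointwise differences of `G`; this file supplies them at
one frame `K` with `FrameOK R U N μ K` (`‖De_K‖, ‖D²e_K‖ ≤ 7`) from k3c2-p3 / k3c3-p2's torus lemmas (`norm_sliceSymbolTorus_le`,
`norm_fwdDiff_three/two_space_sliceSymbolTorus_le(_of_le)`, `norm_fwdDiff_three_time_sliceSymbolTorus_le`) with the cutoff numerals `B₁ = 32/3`,
`B₂ = 448e²/3`, `B₃ = 44900`:

* §0 helpers: `fwdDiff_iter_const_mul`, `card_filter_timeTorus_le_card_filter`, `klScale_one_lt_matsubara_window₅` (`klBetaMin ≤ β ≤ M ⇒ Λ₁ < π(2M−5)/β`),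
  `norm_toLp_unitStep`, `pi_single_zmod_eq_intCast`, `unitDirs_sq`;
* §1 `norm_invVol_sq`, **`plainSymbol_sup_le`**, **`plainSymbol_three_space_le`** (`≤ (βV²)⁻²·(βV²·(2π/V)³·X₃(K₃))`,
  `X₃ = D₃(7+42π)³/Λ₂⁴ + 21D₂(7+42π)/Λ₂³ + D₁K₃/Λ₂²`), **`plainSymbol_two_space_le`** (`X₂ = D₂(7+28π)²/Λ₂³ + 7D₁/Λ₂²`), **`plainSymbol_three_time_le`**
  (`≤ (βV²)⁻²·(2π/β)³·D₃βV²/Λ₂⁴`), `D₁ = 16B₁+16`, `D₂ = 32B₂+144B₁+128`, `D₃ = 64B₃+480B₂+1728B₁+1536`.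
Parts 2b/2c (`…StepCovZeroPlainL1`, `…StepCovZeroPlainSectional`) assemble the all-times and sectional weighted `ℓ¹` bounds from these.

Everything is proved; no definitions, no sorry.  Nothing asserts any stub, K3, VL or superconductivity.
[cite: BenfattoGiulianiMastropietro2006, Lemma 2.2 (2.36aa), (2.52)–(2.55), §2.5 (2.50)]
-/

noncomputable section

namespace Summit.HubbardSuperconductivity.HubbardSuperconductivity.Theorems.TorusFourierL2

set_option linter.dupNamespace false -- summit = problem name (single-conjunct summit), D-0017

open Set Finset Literature.MathematicalPhysics.QuantumLattice Literature.MathematicalPhysics.QuantumLattice.BandSectorCounting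
open Literature.MathematicalPhysics.QuantumLattice.FermiRG Literature.Probability.LatticeModels Literature.Analysis.SpecialFunctions
open Summit.HubbardSuperconductivity.HubbardSuperconductivity.Theorems.DispersionFlow
open Summit.HubbardSuperconductivity.HubbardSuperconductivity.Theorems.KLRegimeSplit
open Summit.HubbardSuperconductivity.HubbardSuperconductivity.Theorems.KLProgrammeLegKernels
open Summit.HubbardSuperconductivity.HubbardSuperconductivity.Theorems.PerturbedFermiCurve
open Summit.HubbardSuperconductivity.HubbardSuperconductivity.Theorems.KLRegimeWick
open Summit.HubbardSuperconductivity.HubbardSuperconductivity.Theorems.TwoVolumeSource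
open scoped Real Nat

open Classical

/-! ## §0 Small helpers -/

section Helpers

/-- Constants pull out of iterated forward differences. [folklore] -/
theorem fwdDiff_iter_const_mul {A : Type*} [AddCommMonoid A] (w : A) (c₀ : ℂ) (Ψ : A → ℂ) (n : ℕ) (x : A) :
    (fwdDiff w)^[n] (fun y => c₀ * Ψ y) x = c₀ * (fwdDiff w)^[n] Ψ x := by
  simp only [fwdDiff_iter_eq_sum_shift, Finset.mul_sum, zsmul_eq_mul]
  exact Finset.sum_congr rfl fun k _ => by ring

/-- The product-torus time labels inject into the Matsubara indices, so a filtered count over the labels is at most the filtered count over the indices.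
[folklore] -/
theorem card_filter_timeTorus_le_card_filter {M : ℕ} [NeZero M] (P : MatsubaraIdx M → Prop) [DecidablePred P] :
    ((univ : Finset (TorusSite 1 (2 * M))).filter fun q₁ => P ⟨(q₁ 0).val, ZMod.val_lt (q₁ 0)⟩).card ≤ ((univ : Finset (MatsubaraIdx M)).filter P).card := by
  refine Finset.card_le_card_of_injOn (fun q₁ => ⟨(q₁ 0).val, ZMod.val_lt (q₁ 0)⟩) (fun q₁ hq => ?_) (fun q₁ _ q₂ _ h => ?_)
  · rw [mem_coe, mem_filter] at hq ⊢
    exact ⟨mem_univ _, hq.2⟩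
  · have h' : (q₁ 0).val = (q₂ 0).val := congrArg Fin.val h
    funext i
    have hi : i = 0 := Subsingleton.elim _ _
    subst hi
    exact ZMod.val_injective _ h'

/-- **The three-step Matsubara window holds in the regime**: `klBetaMin ≤ β ≤ M` gives `Λ₁ = klScale klE0 1 < π(2M−5)/β`. [folklore] -/
theorem klScale_one_lt_matsubara_window₅ {M : ℕ} {β : ℝ} (hβmin : klBetaMin ≤ β) (hβM : β ≤ (M : ℝ)) :
    klScale klE0 1 < π * (2 * (M : ℝ) - 5) / β := by
  have hβ0 : 0 < β := pos_of_klBetaMin_le hβmin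
  have hβ128 : (128 : ℝ) ≤ β := by simpa [klBetaMin] using hβmin
  have hΛ1 : klScale klE0 1 < 3 / 80 := klScale_klE0_lt_tube 1
  have hπ := Real.pi_gt_three
  rw [lt_div_iff₀ hβ0]
  nlinarith

/-- The Euclidean length of a UNIT lattice step `(2π/V)·r`, `r₀² + r₁² = 1`. [folklore] -/
theorem norm_toLp_unitStep (V : ℕ) {r : Fin 2 → ℤ} (hr : (r 0 : ℝ) ^ 2 + (r 1 : ℝ) ^ 2 = 1) :
    ‖(WithLp.toLp 2 (fun j => 2 * π / V * (r j : ℝ)) : EuclideanSpace ℝ (Fin 2))‖ = 2 * π / V := by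
  rw [norm_toLp_latticeStep, hr, Real.sqrt_one, mul_one]

/-- The axis step `e_i` of the spatial torus is the reduction of the integer vector `Pi.single i 1`. [folklore] -/
theorem pi_single_zmod_eq_intCast (V : ℕ) (i : Fin 2) :
    (Pi.single i (1 : ZMod V) : TorusSite 2 V) = fun j => (((Pi.single i (1 : ℤ) : Fin 2 → ℤ) j : ℤ) : ZMod V) := by
  funext j
  by_cases h : j = i
  · subst h; simp
  · simp [h]

/-- The four unit integer directions used at scale `0` (`e₁, e₂`, `e₂^⊥ = −e₁`, `e₂`) have unit length. [folklore] -/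
theorem unitDirs_sq :
    (∀ i : Fin 2, (((Pi.single i (1 : ℤ) : Fin 2 → ℤ) 0 : ℤ) : ℝ) ^ 2 + (((Pi.single i (1 : ℤ) : Fin 2 → ℤ) 1 : ℤ) : ℝ) ^ 2 = 1) ∧
    ((((![-(![0, 1] : Fin 2 → ℤ) 1, (![0, 1] : Fin 2 → ℤ) 0] : Fin 2 → ℤ) 0 : ℤ) : ℝ) ^ 2 +
      (((![-(![0, 1] : Fin 2 → ℤ) 1, (![0, 1] : Fin 2 → ℤ) 0] : Fin 2 → ℤ) 1 : ℤ) : ℝ) ^ 2 = 1) ∧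
    ((((![0, 1] : Fin 2 → ℤ) 0 : ℤ) : ℝ) ^ 2 + (((![0, 1] : Fin 2 → ℤ) 1 : ℤ) : ℝ) ^ 2 = 1) ∧ (![0, 1] : Fin 2 → ℤ) ≠ 0 := by
  refine ⟨fun i => by fin_cases i <;> simp, by simp, by simp, fun h => ?_⟩
  have := congrFun h 1
  simp at this

end Helpers

/-! ## §1 Pointwise data of the plain symbol on the product torus at one admissible frame -/

section Pointwise

variable {V M : ℕ} [NeZero V] [NeZero M] {R : RenConsts} {U : ℝ} {N : ℕ} {μ : ℝ} {K : TrigPolyC4v} {β : ℝ}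

omit [NeZero V] [NeZero M] in
/-- The norm of the constant `((βV²)⁻¹)²`. [folklore] -/
theorem norm_invVol_sq (hβ : 0 < β) : ‖(((1 / (β * (V : ℝ) ^ 2) : ℝ) : ℂ)) ^ 2‖ = (1 / (β * (V : ℝ) ^ 2)) ^ 2 := by
  rw [norm_pow, Complex.norm_real, Real.norm_of_nonneg (by positivity)]

omit [NeZero V] in
/-- **Sup of the plain symbol**: `‖(βV²)⁻²Ψ̂(q)‖ ≤ (βV²)⁻²·4βV²/Λ₂`. [cite: BenfattoGiulianiMastropietro2006, §2.5 (2.50)] -/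
theorem plainSymbol_sup_le (hβ : 0 < β) (μ : ℝ) (K : TrigPolyC4v) (q : TorusSite 1 (2 * M) × TorusSite 2 V) :
    ‖(((1 / (β * (V : ℝ) ^ 2) : ℝ) : ℂ)) ^ 2 *
        sliceSymbolFnXi (β * (V : ℝ) ^ 2) 0 (klScale klE0 2) (klScale klE0 1) (matsubaraFreq β M ⟨(q.1 0).val, ZMod.val_lt (q.1 0)⟩) (nambuXiCT V μ K q.2)‖ ≤
      (1 / (β * (V : ℝ) ^ 2)) ^ 2 * (4 * (β * (V : ℝ) ^ 2) / klScale klE0 2) := by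
  have he : (0 : ℝ) < klE0 := by norm_num [klE0]
  rw [norm_mul, norm_invVol_sq hβ]
  exact mul_le_mul_of_nonneg_left (norm_sliceSymbolTorus_le (β := β) (μ := μ) (K := K) (klth_klScale_pos 2) (EngineV8.klScale_le_klScale he.le (by norm_num))
    (by positivity) q) (by positivity)

/-- **Third spatial difference of the plain symbol along a unit integer direction** (`FrameOK` frame, `‖D³e_K‖ ≤ K₃`):
`‖Δ³_{(0,r̄)}[(βV²)⁻²Ψ̂](q)‖ ≤ (βV²)⁻²·(βV²·(2π/V)³·X₃(K₃))`, `X₃ = D₃(7+42π)³/Λ₂⁴ + 21D₂(7+42π)/Λ₂³ + D₁K₃/Λ₂²` in the cutoff numerals `D₁, D₂, D₃`.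
[cite: BenfattoGiulianiMastropietro2006, Lemma 2.2 (2.52)–(2.55)] -/
theorem plainSymbol_three_space_le (hK : FrameOK R U N μ K) (hβ : 0 < β) {K₃ : ℝ}
    (hK3 : ∀ p, ‖iteratedFDeriv ℝ 3 (frameLevel μ K) p‖ ≤ K₃) (r : Fin 2 → ℤ) (hr : (r 0 : ℝ) ^ 2 + (r 1 : ℝ) ^ 2 = 1)
    (q : TorusSite 1 (2 * M) × TorusSite 2 V) :
    ‖((fwdDiff ((0 : TorusSite 1 (2 * M)), (fun i => ((r i : ℤ) : ZMod V))))^[3]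
        (fun y : TorusSite 1 (2 * M) × TorusSite 2 V => (((1 / (β * (V : ℝ) ^ 2) : ℝ) : ℂ)) ^ 2 *
          sliceSymbolFnXi (β * (V : ℝ) ^ 2) 0 (klScale klE0 2) (klScale klE0 1) (matsubaraFreq β M ⟨(y.1 0).val, ZMod.val_lt (y.1 0)⟩) (nambuXiCT V μ K y.2))) q‖ ≤
      (1 / (β * (V : ℝ) ^ 2)) ^ 2 * ((β * (V : ℝ) ^ 2) * (2 * π / V) ^ 3 *
        ((64 * 44900 + 480 * (448 / 3 * Real.exp 2) + 1728 * (32 / 3) + 1536) * (7 + 42 * π) ^ 3 / klScale klE0 2 ^ 4 +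
          21 * (32 * (448 / 3 * Real.exp 2) + 144 * (32 / 3) + 128) * (7 + 42 * π) / klScale klE0 2 ^ 3 + (16 * (32 / 3) + 16) * K₃ / klScale klE0 2 ^ 2)) := by
  have he : (0 : ℝ) < klE0 := by norm_num [klE0]
  have hΛ2 : 0 < klScale klE0 2 := klth_klScale_pos 2
  have hΛ21 : klScale klE0 2 ≤ klScale klE0 1 := EngineV8.klScale_le_klScale he.le (by norm_num)
  have hV1 : (1 : ℝ) ≤ V := by exact_mod_cast Nat.pos_of_ne_zero (NeZero.ne V)
  have hV0 : (0 : ℝ) < V := by linarith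
  have hc : 0 < β * (V : ℝ) ^ 2 := by positivity
  have hB₁ : ∀ x, |deriv salmhoferCutoff x| ≤ 32 / 3 := klcd_abs_deriv_salmhoferCutoff_le_sharp
  have hB₂ : ∀ x, |deriv (deriv salmhoferCutoff) x| ≤ 448 / 3 * Real.exp 2 := klsd_abs_deriv2_salmhoferCutoff_le
  have hB₃ : ∀ x, |deriv (deriv (deriv salmhoferCutoff)) x| ≤ 44900 := fun x => (kltd_abs_deriv3_salmhoferCutoff_lt x).le
  have hK₁ : ∀ p, ‖fderiv ℝ (frameLevel μ K) p‖ ≤ 7 := fun p => norm_fderiv_frameLevel_le_of_frameOK hK p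
  have hK₂ : ∀ p, ‖iteratedFDeriv ℝ 2 (frameLevel μ K) p‖ ≤ 7 := fun p => norm_iteratedFDeriv_two_frameLevel_le_of_frameOK hK p
  have hstep := norm_toLp_unitStep V hr
  rw [fwdDiff_iter_const_mul, norm_mul, norm_invVol_sq hβ]
  refine mul_le_mul_of_nonneg_left ?_ (by positivity)
  have hτ : |fderiv ℝ (frameLevel μ K) (WithLp.toLp 2 (torusCentredMomentum V q.2)) (WithLp.toLp 2 (fun i => 2 * π / V * (r i : ℝ)))| ≤ 7 * (2 * π / V) := by
    rw [← Real.norm_eq_abs, ← hstep]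
    exact (ContinuousLinearMap.le_opNorm _ _).trans (mul_le_mul_of_nonneg_right (hK₁ _) (norm_nonneg _))
  have h3 := norm_fwdDiff_three_space_sliceSymbolTorus_le_of_le (c := β * (V : ℝ) ^ 2) (β := β) (M := M) hK₂ hK3 hΛ2 hΛ21 hc.le hB₁ hB₂ hB₃ r q hτ
  rw [hstep] at h3
  refine h3.trans ?_
  set ℓ : ℝ := 2 * π / V with hℓdef
  set Λ₂ : ℝ := klScale klE0 2 with hΛ₂def
  set D₁ : ℝ := 16 * (32 / 3 : ℝ) + 16 with hD₁
  set D₂ : ℝ := 32 * (448 / 3 * Real.exp 2) + 144 * (32 / 3 : ℝ) + 128 with hD₂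
  set D₃ : ℝ := 64 * (44900 : ℝ) + 480 * (448 / 3 * Real.exp 2) + 1728 * (32 / 3 : ℝ) + 1536 with hD₃
  have hD₁0 : 0 < D₁ := by rw [hD₁]; norm_num
  have hD₂0 : 0 < D₂ := by rw [hD₂]; positivity
  have hD₃0 : 0 < D₃ := by rw [hD₃]; positivity
  have hℓ0 : 0 < ℓ := by positivity
  have hℓ : ℓ ≤ 2 * π := by
    rw [hℓdef, div_le_iff₀ hV0]
    have := mul_le_mul_of_nonneg_left hV1 (by positivity : (0 : ℝ) ≤ 2 * π)
    linarith
  have hll : ℓ * ℓ ≤ ℓ * (2 * π) := mul_le_mul_of_nonneg_left hℓ hℓ0.le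
  have hb0 : 0 ≤ 7 * ℓ + 3 * (7 * ℓ ^ 2) := by positivity
  have hb : 7 * ℓ + 3 * (7 * ℓ ^ 2) ≤ ℓ * (7 + 42 * π) := by nlinarith [hll]
  have h1 : (7 * ℓ + 3 * (7 * ℓ ^ 2)) ^ 3 ≤ ℓ ^ 3 * (7 + 42 * π) ^ 3 := by
    calc (7 * ℓ + 3 * (7 * ℓ ^ 2)) ^ 3 ≤ (ℓ * (7 + 42 * π)) ^ 3 := pow_le_pow_left₀ hb0 hb 3
      _ = ℓ ^ 3 * (7 + 42 * π) ^ 3 := by ring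
  have hl3 : ℓ ^ 3 * ℓ ≤ ℓ ^ 3 * (2 * π) := mul_le_mul_of_nonneg_left hℓ (by positivity)
  have h2 : (7 * ℓ + 3 * (7 * ℓ ^ 2)) * (7 * ℓ ^ 2) ≤ 7 * (7 + 42 * π) * ℓ ^ 3 := by nlinarith [hl3]
  have e : β * (V : ℝ) ^ 2 * ℓ ^ 3 * (D₃ * (7 + 42 * π) ^ 3 / Λ₂ ^ 4 + 21 * D₂ * (7 + 42 * π) / Λ₂ ^ 3 + D₁ * K₃ / Λ₂ ^ 2) =
      D₃ * (β * (V : ℝ) ^ 2) / Λ₂ ^ 4 * (ℓ ^ 3 * (7 + 42 * π) ^ 3) + 3 * (D₂ * (β * (V : ℝ) ^ 2) / Λ₂ ^ 3 * (7 * (7 + 42 * π) * ℓ ^ 3)) +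
        D₁ * (β * (V : ℝ) ^ 2) / Λ₂ ^ 2 * (K₃ * ℓ ^ 3) := by ring
  rw [e]
  refine add_le_add (add_le_add (mul_le_mul_of_nonneg_left h1 (by positivity)) (mul_le_mul_of_nonneg_left ?_ (by norm_num))) le_rfl
  rw [mul_assoc]
  exact mul_le_mul_of_nonneg_left h2 (by positivity)

/-- **Second spatial difference of the plain symbol along a unit integer direction** (`FrameOK` frame):
`‖Δ²_{(0,r̄)}[(βV²)⁻²Ψ̂](q)‖ ≤ (βV²)⁻²·(βV²·(2π/V)²·X₂)`, `X₂ = D₂(7+28π)²/Λ₂³ + 7D₁/Λ₂²`. [cite: BenfattoGiulianiMastropietro2006, Lemma 2.2 (2.36aa)] -/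
theorem plainSymbol_two_space_le (hK : FrameOK R U N μ K) (hβ : 0 < β) (r : Fin 2 → ℤ) (hr : (r 0 : ℝ) ^ 2 + (r 1 : ℝ) ^ 2 = 1)
    (q : TorusSite 1 (2 * M) × TorusSite 2 V) :
    ‖((fwdDiff ((0 : TorusSite 1 (2 * M)), (fun i => ((r i : ℤ) : ZMod V))))^[2]
        (fun y : TorusSite 1 (2 * M) × TorusSite 2 V => (((1 / (β * (V : ℝ) ^ 2) : ℝ) : ℂ)) ^ 2 *
          sliceSymbolFnXi (β * (V : ℝ) ^ 2) 0 (klScale klE0 2) (klScale klE0 1) (matsubaraFreq β M ⟨(y.1 0).val, ZMod.val_lt (y.1 0)⟩) (nambuXiCT V μ K y.2))) q‖ ≤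
      (1 / (β * (V : ℝ) ^ 2)) ^ 2 * ((β * (V : ℝ) ^ 2) * (2 * π / V) ^ 2 *
        ((32 * (448 / 3 * Real.exp 2) + 144 * (32 / 3) + 128) * (7 + 28 * π) ^ 2 / klScale klE0 2 ^ 3 + 7 * (16 * (32 / 3) + 16) / klScale klE0 2 ^ 2)) := by
  have he : (0 : ℝ) < klE0 := by norm_num [klE0]
  have hΛ2 : 0 < klScale klE0 2 := klth_klScale_pos 2
  have hΛ21 : klScale klE0 2 ≤ klScale klE0 1 := EngineV8.klScale_le_klScale he.le (by norm_num)
  have hV1 : (1 : ℝ) ≤ V := by exact_mod_cast Nat.pos_of_ne_zero (NeZero.ne V)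
  have hV0 : (0 : ℝ) < V := by linarith
  have hc : 0 < β * (V : ℝ) ^ 2 := by positivity
  have hB₁ : ∀ x, |deriv salmhoferCutoff x| ≤ 32 / 3 := klcd_abs_deriv_salmhoferCutoff_le_sharp
  have hB₂ : ∀ x, |deriv (deriv salmhoferCutoff) x| ≤ 448 / 3 * Real.exp 2 := klsd_abs_deriv2_salmhoferCutoff_le
  have hK₁ : ∀ p, ‖fderiv ℝ (frameLevel μ K) p‖ ≤ 7 := fun p => norm_fderiv_frameLevel_le_of_frameOK hK p
  have hK₂ : ∀ p, ‖iteratedFDeriv ℝ 2 (frameLevel μ K) p‖ ≤ 7 := fun p => norm_iteratedFDeriv_two_frameLevel_le_of_frameOK hK p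
  have hstep := norm_toLp_unitStep V hr
  rw [fwdDiff_iter_const_mul, norm_mul, norm_invVol_sq hβ]
  refine mul_le_mul_of_nonneg_left ?_ (by positivity)
  have hτ : |fderiv ℝ (frameLevel μ K) (WithLp.toLp 2 (torusCentredMomentum V q.2)) (WithLp.toLp 2 (fun i => 2 * π / V * (r i : ℝ)))| ≤ 7 * (2 * π / V) := by
    rw [← Real.norm_eq_abs, ← hstep]
    exact (ContinuousLinearMap.le_opNorm _ _).trans (mul_le_mul_of_nonneg_right (hK₁ _) (norm_nonneg _))
  have h2 := norm_fwdDiff_two_space_sliceSymbolTorus_le (c := β * (V : ℝ) ^ 2) (β := β) (M := M) hK₂ hΛ2 hΛ21 hc.le hB₁ hB₂ r q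
  rw [hstep] at h2
  refine h2.trans ?_
  set ℓ : ℝ := 2 * π / V with hℓdef
  set Λ₂ : ℝ := klScale klE0 2 with hΛ₂def
  set D₁ : ℝ := 16 * (32 / 3 : ℝ) + 16 with hD₁
  set D₂ : ℝ := 32 * (448 / 3 * Real.exp 2) + 144 * (32 / 3 : ℝ) + 128 with hD₂
  have hD₁0 : 0 < D₁ := by rw [hD₁]; norm_num
  have hD₂0 : 0 < D₂ := by rw [hD₂]; positivity
  have hℓ0 : 0 < ℓ := by positivity
  have hℓ : ℓ ≤ 2 * π := by
    rw [hℓdef, div_le_iff₀ hV0]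
    have := mul_le_mul_of_nonneg_left hV1 (by positivity : (0 : ℝ) ≤ 2 * π)
    linarith
  have hll : ℓ * ℓ ≤ ℓ * (2 * π) := mul_le_mul_of_nonneg_left hℓ hℓ0.le
  have hτ' : |fderiv ℝ (frameLevel μ K) (WithLp.toLp 2 (torusCentredMomentum V q.2)) (WithLp.toLp 2 (fun i => 2 * π / V * (r i : ℝ)))| ≤ 7 * ℓ := hτ
  have hτ0 : 0 ≤ |fderiv ℝ (frameLevel μ K) (WithLp.toLp 2 (torusCentredMomentum V q.2)) (WithLp.toLp 2 (fun i => 2 * π / V * (r i : ℝ)))| := abs_nonneg _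
  have hb : |fderiv ℝ (frameLevel μ K) (WithLp.toLp 2 (torusCentredMomentum V q.2)) (WithLp.toLp 2 (fun i => 2 * π / V * (r i : ℝ)))| + 2 * (7 * ℓ ^ 2) ≤
      ℓ * (7 + 28 * π) := by nlinarith [hll, hτ']
  have h1 : (|fderiv ℝ (frameLevel μ K) (WithLp.toLp 2 (torusCentredMomentum V q.2)) (WithLp.toLp 2 (fun i => 2 * π / V * (r i : ℝ)))| + 2 * (7 * ℓ ^ 2)) ^ 2 ≤
      ℓ ^ 2 * (7 + 28 * π) ^ 2 := by
    calc _ ≤ (ℓ * (7 + 28 * π)) ^ 2 := pow_le_pow_left₀ (by positivity) hb 2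
      _ = ℓ ^ 2 * (7 + 28 * π) ^ 2 := by ring
  have e : β * (V : ℝ) ^ 2 * ℓ ^ 2 * (D₂ * (7 + 28 * π) ^ 2 / Λ₂ ^ 3 + 7 * D₁ / Λ₂ ^ 2) =
      D₂ * (β * (V : ℝ) ^ 2) / Λ₂ ^ 3 * (ℓ ^ 2 * (7 + 28 * π) ^ 2) + D₁ * (β * (V : ℝ) ^ 2) / Λ₂ ^ 2 * (7 * ℓ ^ 2) := by ring
  rw [e]
  exact add_le_add (mul_le_mul_of_nonneg_left h1 (by positivity)) le_rfl

omit [NeZero V] in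
/-- **Third time difference of the plain symbol** in the regime window (`klBetaMin ≤ β ≤ M`, so `Λ₁ < π(2M−5)/β`):
`‖Δ³_{(1,0)}[(βV²)⁻²Ψ̂](q)‖ ≤ (βV²)⁻²·(2π/β)³·D₃·βV²/Λ₂⁴`. [cite: BenfattoGiulianiMastropietro2006, Lemma 2.2 (2.52)] -/
theorem plainSymbol_three_time_le (hβmin : klBetaMin ≤ β) (hβM : β ≤ (M : ℝ)) (μ : ℝ) (K : TrigPolyC4v) (q : TorusSite 1 (2 * M) × TorusSite 2 V) :
    ‖((fwdDiff ((fun _ : Fin 1 => (1 : ZMod (2 * M))), (0 : TorusSite 2 V)))^[3]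
        (fun y : TorusSite 1 (2 * M) × TorusSite 2 V => (((1 / (β * (V : ℝ) ^ 2) : ℝ) : ℂ)) ^ 2 *
          sliceSymbolFnXi (β * (V : ℝ) ^ 2) 0 (klScale klE0 2) (klScale klE0 1) (matsubaraFreq β M ⟨(y.1 0).val, ZMod.val_lt (y.1 0)⟩) (nambuXiCT V μ K y.2))) q‖ ≤
      (1 / (β * (V : ℝ) ^ 2)) ^ 2 * ((2 * π / β) ^ 3 *
        ((64 * 44900 + 480 * (448 / 3 * Real.exp 2) + 1728 * (32 / 3) + 1536) * (β * (V : ℝ) ^ 2) / klScale klE0 2 ^ 4)) := by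
  have he : (0 : ℝ) < klE0 := by norm_num [klE0]
  have hΛ2 : 0 < klScale klE0 2 := klth_klScale_pos 2
  have hΛ21 : klScale klE0 2 ≤ klScale klE0 1 := EngineV8.klScale_le_klScale he.le (by norm_num)
  have hβ0 : 0 < β := pos_of_klBetaMin_le hβmin
  have hc : 0 ≤ β * (V : ℝ) ^ 2 := by positivity
  have hB₁ : ∀ x, |deriv salmhoferCutoff x| ≤ 32 / 3 := klcd_abs_deriv_salmhoferCutoff_le_sharp
  have hB₂ : ∀ x, |deriv (deriv salmhoferCutoff) x| ≤ 448 / 3 * Real.exp 2 := klsd_abs_deriv2_salmhoferCutoff_le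
  have hB₃ : ∀ x, |deriv (deriv (deriv salmhoferCutoff)) x| ≤ 44900 := fun x => (kltd_abs_deriv3_salmhoferCutoff_lt x).le
  have hMw := klScale_one_lt_matsubara_window₅ hβmin hβM
  rw [fwdDiff_iter_const_mul, norm_mul, norm_invVol_sq hβ0]
  exact mul_le_mul_of_nonneg_left (norm_fwdDiff_three_time_sliceSymbolTorus_le (c := β * (V : ℝ) ^ 2) (L := V) (μ := μ) (K := K)
    hβ0 hΛ2 hΛ21 hMw hc hB₁ hB₂ hB₃ q) (by positivity)

end Pointwise

end Summit.HubbardSuperconductivity.HubbardSuperconductivity.Theorems.TorusFourierL2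

end
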